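import Summits.Ventures.YMGap.RobustBall.PerturbedReflectionCovariance
import HarnessLib

/-!
# Venture YMGap, track ROBUST-BALL — ONE STATE, step 15: the one state of a reflection-symmetric member is reflection
# symmetric; the Wilson one state carries the full hyperoctahedral symmetry of the lattice

HONEST FRAMING. WHAT THIS IS: a venture file (cell `pub-ymgap`, track Y2 ROBUST-BALL, seat ds-3, theorems only), the
consequences of `PerturbedReflectionCovariance.lean`: ★ the tier-1 perturbed specification of a member whose finite-volume
Hamiltonians are reflection covariant is reflection covariant (`perturbedYM_map_configSiteReflect` — the generic twisted
relabelling `Covariance.tilted_glueWith_map_twist` with the reflected-link relabelling twisted by inversion on the links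
along the mirror direction; Haar measure is inversion invariant), its DLR set is reflection stable
(`map_configSiteReflect_mem_perturbedGibbsMeasures`), and ★★ in the uniqueness regime THE ONE STATE IS INVARIANT UNDER THE
AXIS REFLECTION (`oneState_reflectInvariant_of_perturbedMassGapAt`). WILSON (every `d ≥ 1`, `N`):
★★ `oneState_hyperoctahedral_of_massGapAt` — under `MassGapAt d N β` the one state (unique DLR state = the only torus limit)
is invariant under every lattice translation, every permutation of the axes AND every axis reflection `x_i ↦ −x_i`, i.e.
under the full hyperoctahedral space group of `ℤ^d` (reflections through the gauge-boot cell's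
`map_configSiteReflect_eq_of_mem_infiniteVolumeLimitPoints`: every torus limit point is reflection invariant); cells
`su2_wilson_oneState_hyperoctahedral` (`|b| ≤ 9/50`, i.e. Wilson `|β_W| ≤ 9/25`) and `suN_wilson_oneState_hyperoctahedral_sharp`
(every `N ≥ 2`, `d ≥ 2`, `|β| < 1/(8d)`). MEMBER: the adjoint-plaquette (Bhanot–Creutz) witness is reflection covariant
(`adjointWitness_reflect`, `plaquetteSupp_reflect`) ⇒ ★ `su2_mixedAction_oneState_reflectInvariant` (`β_W = 1/8`, `|t| ≤ 1/100`:
the one state is invariant under all four axis reflections, completing its hyperoctahedral symmetry). WHAT THIS IS NOT: reflection POSITIVITY of the one state is not touched here;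
lattice statements only, nothing about the continuum limit or the Clay Millennium problem.

References: H.-O. Georgii (2011), §5.1; E. Seiler, LNP 159 (1982), Ch. 1–2; the gauge-boot cell's `ClassB.lean`,
`ClassBLimitSymmetry.lean`; the track's `PerturbedReflectionCovariance.lean`, `PerturbedAxisCovariance.lean`,
`WilsonOneStateSymmetry.lean`.
-/

noncomputable section

open MeasureTheory Filter Function
open Literature.Probability.LatticeModels hiding configShift configShift_apply
open Literature.MathematicalPhysics.QuantumLattice
open Literature.MathematicalPhysics.QuantumFieldTheory hiding ZdEdge Site
open Summit.QuantumFields.GaugeBoot (zdSiteReflect configSiteReflect configSiteReflect_apply zdSiteReflect_zdSiteReflect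
  zdSiteReflect_sub_single configSiteReflect_configSiteReflect measurable_configSiteReflect)

namespace Summit.Ventures.YMGap.RobustBall

/-! ### The perturbed specification under reflections; the one state -/

section Carriers

variable {d N : ℕ} {G : Type*} [Group G] (ρ : G →* Matrix (Fin N) (Fin N) ℂ)

variable [TopologicalSpace G] [IsTopologicalGroup G] [CompactSpace G] [MeasurableSpace G] [BorelSpace G]
  [SecondCountableTopology G]

/-- ★ **Reflection covariance of the tier-1 perturbed specification**: if the member's finite-volume Hamiltonians are
reflection covariant, `H^W_{𝓻Λ}(configSiteReflect i U) = H^W_Λ(U)`, then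
`γ^W_Λ(· | η) ∘ (configSiteReflect i)⁻¹ = γ^W_{𝓻Λ}(· | configSiteReflect i η)` — `Covariance.tilted_glueWith_map_twist` with
the relabelling `𝓻` twisted by inversion on the links along direction `i` (Haar measure is inversion invariant).
[folklore] -/
theorem perturbedYM_map_configSiteReflect (hρ : Continuous ρ) (β : ℝ) {W : Potential (ZdEdge d) G}
    (hWc : ∀ X, Continuous (W X)) (supp : Finset (ZdEdge d) → Finset (Finset (ZdEdge d)))
    (Λ : Finset (ZdEdge d)) (i : Fin d)
    (hH : ∀ U : LGConfig d G,
      hamiltonianIn W supp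
          (Λ.image (fun x : ZdEdge d =>
        if x.2 = i then (zdSiteReflect i x.1 - Pi.single i 1, i) else (zdSiteReflect i x.1, x.2)))
          (configSiteReflect i U) = hamiltonianIn W supp Λ U)
    (η : LGConfig d G) :
    (perturbedYM ρ β W supp Λ η).map (configSiteReflect i) =
      perturbedYM ρ β W supp
        (Λ.image (fun x : ZdEdge d =>
        if x.2 = i then (zdSiteReflect i x.1 - Pi.single i 1, i) else (zdSiteReflect i x.1, x.2)))
        (configSiteReflect i η) := by
  classical
  have hinv := reflectEdge_involutive (d := d) i
  set e : ZdEdge d ≃ ZdEdge d := hinv.toPerm _ with he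
  have hmap : Λ.map e.toEmbedding =
      Λ.image (fun x : ZdEdge d =>
        if x.2 = i then (zdSiteReflect i x.1 - Pi.single i 1, i) else (zdSiteReflect i x.1, x.2)) := by
    rw [Finset.map_eq_image]
    rfl
  let T : LGConfig d G ≃ᵐ LGConfig d G :=
    { toFun := configSiteReflect i, invFun := configSiteReflect i,
      left_inv := configSiteReflect_configSiteReflect i, right_inv := configSiteReflect_configSiteReflect i,
      measurable_toFun := measurable_configSiteReflect i, measurable_invFun := measurable_configSiteReflect i }
  have hT : ∀ (U : LGConfig d G) (x : ZdEdge d), T U x =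
      (fun x : ZdEdge d => if x.2 = i then MeasurableEquiv.inv G else MeasurableEquiv.refl G) x (U (e.symm x)) := by
    intro U x
    show configSiteReflect i U x = _
    rw [Function.Involutive.toPerm_symm, Function.Involutive.coe_toPerm]
    by_cases hx : x.2 = i
    · simp only [configSiteReflect_apply, hx, ↓reduceIte]
      rfl
    · simp only [configSiteReflect_apply, hx, ↓reduceIte]
      rfl
  have hφ : ∀ x : ZdEdge d, MeasurePreserving
      ((fun x : ZdEdge d => if x.2 = i then MeasurableEquiv.inv G else MeasurableEquiv.refl G) x)
      (haarProbability G) (haarProbability G) := by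
    intro x
    by_cases hx : x.2 = i
    · simp only [hx, ↓reduceIte]
      exact Measure.measurePreserving_inv (haarProbability G)
    · simp only [hx, ↓reduceIte]
      exact MeasurePreserving.id _
  have hcov : ∀ U : LGConfig d G, perturbedEnergy ρ β W supp (Λ.map e.toEmbedding) (T U) =
      perturbedEnergy ρ β W supp Λ U := fun U => by
    rw [hmap]
    change perturbedEnergy ρ β W supp _ (configSiteReflect i U) = _
    simp only [perturbedEnergy, wilsonBoundaryAction_reflect ρ hρ, hH]
  have key := Covariance.tilted_glueWith_map_twist _ _ (continuous_perturbedEnergy ρ hρ β hWc supp Λ)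
    (continuous_perturbedEnergy ρ hρ β hWc supp _) Λ T e _ hT hφ hcov η
  rw [← hmap]
  exact key

/-- ★ **Tier 1: the image of a DLR state of a reflection-symmetric member under an axis reflection is a DLR state.**
[folklore] -/
theorem map_configSiteReflect_mem_perturbedGibbsMeasures [T2Space G] (hρ : Continuous ρ) (β : ℝ)
    {W : Potential (ZdEdge d) G} (hWc : ∀ X, Continuous (W X)) (hdep : ∀ X, DependsOn (W X) (↑X : Set (ZdEdge d)))
    {supp : Finset (ZdEdge d) → Finset (Finset (ZdEdge d))} (hsupp : W.IsSupportedBy supp) (i : Fin d)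
    (hH : ∀ (Λ : Finset (ZdEdge d)) (U : LGConfig d G),
      hamiltonianIn W supp
          (Λ.image (fun x : ZdEdge d =>
        if x.2 = i then (zdSiteReflect i x.1 - Pi.single i 1, i) else (zdSiteReflect i x.1, x.2)))
          (configSiteReflect i U) = hamiltonianIn W supp Λ U)
    {μ : Measure (LGConfig d G)} (hμ : μ ∈ perturbedGibbsMeasures (d := d) ρ β W supp) :
    μ.map (configSiteReflect i) ∈ perturbedGibbsMeasures (d := d) ρ β W supp := by
  classical
  have hinv := reflectEdge_involutive (d := d) i
  set e : ZdEdge d ≃ ZdEdge d := hinv.toPerm _ with he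
  have hmap : ∀ Λ : Finset (ZdEdge d), Λ.map e.toEmbedding =
      Λ.image (fun x : ZdEdge d =>
        if x.2 = i then (zdSiteReflect i x.1 - Pi.single i 1, i) else (zdSiteReflect i x.1, x.2)) := fun Λ => by
    rw [Finset.map_eq_image]
    rfl
  let T : LGConfig d G ≃ᵐ LGConfig d G :=
    { toFun := configSiteReflect i, invFun := configSiteReflect i,
      left_inv := configSiteReflect_configSiteReflect i, right_inv := configSiteReflect_configSiteReflect i,
      measurable_toFun := measurable_configSiteReflect i, measurable_invFun := measurable_configSiteReflect i }
  exact Covariance.map_equiv_mem_gibbsMeasures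
    (isSpecification_perturbedYM ρ hρ β (fun X => ⟨hdep X, (hWc X).measurable⟩)
      (fun X => exists_bound_of_continuous (hWc X)) hsupp)
    T e (fun Λ η => by rw [hmap]; exact perturbedYM_map_configSiteReflect ρ hρ β hWc supp Λ i (hH Λ) η) hμ

end Carriers

section Currencies

variable {d N : ℕ}

/-- ★★ **TIER 1: THE ONE STATE OF A REFLECTION-SYMMETRIC MEMBER IS REFLECTION-SYMMETRIC.** Under `PerturbedMassGapAt d N β W supp`
(continuous terms reading their own links, locally finite support) and reflection covariance of the finite-volume
Hamiltonians in direction `i`, the one DLR state `μ` satisfies `μ ∘ (configSiteReflect i)⁻¹ = μ`. [folklore] -/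
theorem oneState_reflectInvariant_of_perturbedMassGapAt {β : ℝ} {W : Potential (ZdEdge d) (SUN N)}
    {supp : Finset (ZdEdge d) → Finset (Finset (ZdEdge d))} (hgap : PerturbedMassGapAt d N β W supp)
    (hWc : ∀ X, Continuous (W X)) (hdep : ∀ X, DependsOn (W X) (↑X : Set (ZdEdge d)))
    (hsupp : W.IsSupportedBy supp) (i : Fin d)
    (hH : ∀ (Λ : Finset (ZdEdge d)) (U : LGConfig d (SUN N)),
      hamiltonianIn W supp
          (Λ.image (fun x : ZdEdge d =>
        if x.2 = i then (zdSiteReflect i x.1 - Pi.single i 1, i) else (zdSiteReflect i x.1, x.2)))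
          (configSiteReflect i U) = hamiltonianIn W supp Λ U) :
    ∃ μ : Measure (LGConfig d (SUN N)),
      perturbedGibbsMeasures (d := d) (fundamentalRep (Fin N)) ((N : ℝ) * β) W supp = {μ} ∧
        μ.map (configSiteReflect i) = μ := by
  haveI : SecondCountableTopology (Matrix (Fin N) (Fin N) ℂ) :=
    inferInstanceAs (SecondCountableTopology (Fin N → Fin N → ℂ))
  haveI : SecondCountableTopology (SUN N) := Topology.IsEmbedding.subtypeVal.secondCountableTopology
  obtain ⟨hsub, ⟨μ, hμ⟩⟩ := hgap.1
  exact ⟨μ, Set.eq_singleton_iff_unique_mem.2 ⟨hμ, fun ν hν => hsub hν hμ⟩,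
    hsub (map_configSiteReflect_mem_perturbedGibbsMeasures _ (continuous_fundamentalRep (Fin N)) _ hWc hdep hsupp i hH hμ)
      hμ⟩

/-- ★★ **WILSON ACTION (every `d ≥ 1`, `N`): THE ONE STATE CARRIES THE FULL HYPEROCTAHEDRAL SYMMETRY OF THE LATTICE.** Under
`MassGapAt d N β` there is one probability measure `μ` with `ymGibbsMeasures = {μ}` (unique DLR state),
`infiniteVolumeLimitPoints = {μ}` (the only torus limit), invariant under every lattice translation, every permutation of
the axes and every axis reflection `x_i ↦ −x_i` (`configSiteReflect i`) — translations, permutations and reflections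
generate the hyperoctahedral space group of `ℤ^d`. Reflections: the gauge-boot cell's
`map_configSiteReflect_eq_of_mem_infiniteVolumeLimitPoints` (every torus limit point is reflection invariant).
[folklore] -/
theorem oneState_hyperoctahedral_of_massGapAt [NeZero d] {β : ℝ} (hgap : MassGapAt d N β) :
    ∃ μ : Measure (LGConfig d (SUN N)),
      ymGibbsMeasures (d := d) (fundamentalRep (Fin N)) ((N : ℝ) * β) = {μ} ∧
      infiniteVolumeLimitPoints (d := d) (fundamentalRep (Fin N)) ((N : ℝ) * β) = {μ} ∧
      IsZdTranslationInvariant μ ∧ (∀ π : Equiv.Perm (Fin d), μ.map (configPermZd π) = μ) ∧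
      ∀ i : Fin d, μ.map (configSiteReflect i) = μ := by
  haveI : SecondCountableTopology (Matrix (Fin N) (Fin N) ℂ) :=
    inferInstanceAs (SecondCountableTopology (Fin N → Fin N → ℂ))
  haveI : SecondCountableTopology (SUN N) := Topology.IsEmbedding.subtypeVal.secondCountableTopology
  obtain ⟨μ, hG, hL, hT, hP⟩ := oneState_symmetric_of_massGapAt hgap
  have hμL : μ ∈ infiniteVolumeLimitPoints (d := d) (fundamentalRep (Fin N)) ((N : ℝ) * β) := by
    rw [hL]; exact Set.mem_singleton μ
  exact ⟨μ, hG, hL, hT, hP, fun i =>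
    Summit.QuantumFields.GaugeBoot.map_configSiteReflect_eq_of_mem_infiniteVolumeLimitPoints (fundamentalRep (Fin N))
      (continuous_fundamentalRep (Fin N)) hμL i⟩

/-- ★ **`SU(2)` Wilson on `ℤ⁴`, TWO-SIDED, every `|b| ≤ 9/50` (Wilson `|β_W| ≤ 9/25`)**: the one state is invariant under all
translations, all `24` axis permutations and all `4` axis reflections of `ℤ⁴` (the hyperoctahedral group of order `384`,
times translations). [folklore] -/
theorem su2_wilson_oneState_hyperoctahedral {b : ℝ} (h : |b| ≤ 9 / 50) :
    ∃ μ : Measure (LGConfig 4 (SUN 2)),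
      ymGibbsMeasures (d := 4) (fundamentalRep (Fin 2)) b = {μ} ∧
      infiniteVolumeLimitPoints (d := 4) (fundamentalRep (Fin 2)) b = {μ} ∧
      IsZdTranslationInvariant μ ∧ (∀ π : Equiv.Perm (Fin 4), μ.map (configPermZd π) = μ) ∧
      ∀ i : Fin 4, μ.map (configSiteReflect i) = μ := by
  have hm := ImprovedThresholdStar.su2_massGapAt_of_abs_le (β := b / 2) (by rw [abs_div, abs_two]; linarith)
  have e : (((2 : ℕ) : ℝ)) * (b / 2) = b := by push_cast; ring
  have h := oneState_hyperoctahedral_of_massGapAt hm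
  rwa [e] at h

/-- ★ **Every `N ≥ 2`, every `d ≥ 2`, the SHARP window `|β| < 1/(8d)`, hypothesis-free**: the one state of `SU(N)` lattice
Yang–Mills at tree coupling `N β` carries the full hyperoctahedral symmetry (translations, axis permutations, axis
reflections). [folklore] -/
theorem suN_wilson_oneState_hyperoctahedral_sharp (hd : 2 ≤ d) (hN : 2 ≤ N) {β : ℝ}
    (hβ : |β| < HessianSharp.sharpThresholdSU d) :
    ∃ μ : Measure (LGConfig d (SUN N)),
      ymGibbsMeasures (d := d) (fundamentalRep (Fin N)) ((N : ℝ) * β) = {μ} ∧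
      infiniteVolumeLimitPoints (d := d) (fundamentalRep (Fin N)) ((N : ℝ) * β) = {μ} ∧
      IsZdTranslationInvariant μ ∧ (∀ π : Equiv.Perm (Fin d), μ.map (configPermZd π) = μ) ∧
      ∀ i : Fin d, μ.map (configSiteReflect i) = μ := by
  haveI : NeZero d := ⟨by omega⟩
  exact oneState_hyperoctahedral_of_massGapAt (SharpUniquenessJoin.massGapAt_sharp_free hd hN hβ)

end Currencies

section Adjoint

variable {d N : ℕ}

/-- The reflected links of a plaquette are the links of a plaquette, and conversely. [folklore] -/
theorem exists_plaquetteEdges_eq_image_reflect_iff (i : Fin d) (X : Finset (ZdEdge d)) :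
    (∃ p : ZdPlaquette d, plaquetteEdges p =
        X.image (fun x : ZdEdge d =>
        if x.2 = i then (zdSiteReflect i x.1 - Pi.single i 1, i) else (zdSiteReflect i x.1, x.2))) ↔
      ∃ p : ZdPlaquette d, plaquetteEdges p = X := by
  classical
  have hinv := reflectEdge_involutive (d := d) i
  have hii : ∀ Y : Finset (ZdEdge d),
      (Y.image (fun x : ZdEdge d =>
        if x.2 = i then (zdSiteReflect i x.1 - Pi.single i 1, i) else (zdSiteReflect i x.1, x.2))).image
        (fun x : ZdEdge d =>
        if x.2 = i then (zdSiteReflect i x.1 - Pi.single i 1, i) else (zdSiteReflect i x.1, x.2)) = Y := fun Y => by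
    rw [Finset.image_image, hinv.comp_self, Finset.image_id]
  constructor
  · rintro ⟨p, hp⟩
    obtain ⟨p', hp', -⟩ :=
      exists_plaquette_reflect (G := SUN 1) (fundamentalRep (Fin 1)) (continuous_fundamentalRep (Fin 1)) i p
    exact ⟨p', by rw [hp', hp, hii]⟩
  · rintro ⟨p, hp⟩
    obtain ⟨p', hp', -⟩ :=
      exists_plaquette_reflect (G := SUN 1) (fundamentalRep (Fin 1)) (continuous_fundamentalRep (Fin 1)) i p
    exact ⟨p', by rw [hp', hp]⟩

/-- **The plaquette support family is reflection covariant.** [folklore] -/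
theorem plaquetteSupp_reflect (i : Fin d) (Λ : Finset (ZdEdge d)) :
    plaquetteSupp (Λ.image (fun x : ZdEdge d =>
        if x.2 = i then (zdSiteReflect i x.1 - Pi.single i 1, i) else (zdSiteReflect i x.1, x.2))) =
      (plaquetteSupp Λ).image (Finset.image (fun x : ZdEdge d =>
        if x.2 = i then (zdSiteReflect i x.1 - Pi.single i 1, i) else (zdSiteReflect i x.1, x.2))) := by
  classical
  have hinv := reflectEdge_involutive (d := d) i
  have hii : ∀ Y : Finset (ZdEdge d),
      (Y.image (fun x : ZdEdge d =>
        if x.2 = i then (zdSiteReflect i x.1 - Pi.single i 1, i) else (zdSiteReflect i x.1, x.2))).image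
        (fun x : ZdEdge d =>
        if x.2 = i then (zdSiteReflect i x.1 - Pi.single i 1, i) else (zdSiteReflect i x.1, x.2)) = Y := fun Y => by
    rw [Finset.image_image, hinv.comp_self, Finset.image_id]
  ext X
  simp only [plaquetteSupp, Finset.mem_image, mem_plaquettesTouching_iff]
  constructor
  · rintro ⟨p, hp, rfl⟩
    obtain ⟨q, hq, -⟩ :=
      exists_plaquette_reflect (G := SUN 1) (fundamentalRep (Fin 1)) (continuous_fundamentalRep (Fin 1)) i p
    refine ⟨plaquetteEdges q, ⟨q, ?_, rfl⟩, ?_⟩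
    · rw [hq, ← hii Λ, ← Finset.image_inter _ _ hinv.injective, Finset.image_nonempty]
      exact hp
    · rw [hq, hii]
  · rintro ⟨Y, ⟨q, hq, rfl⟩, rfl⟩
    obtain ⟨p, hp, -⟩ :=
      exists_plaquette_reflect (G := SUN 1) (fundamentalRep (Fin 1)) (continuous_fundamentalRep (Fin 1)) i q
    refine ⟨p, ?_, hp⟩
    rw [hp, ← Finset.image_inter _ _ hinv.injective, Finset.image_nonempty]
    exact hq

/-- **The adjoint-plaquette witness is reflection covariant**: `W_{𝓻X}(configSiteReflect i U) = W_X(U)`. [folklore] -/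
theorem adjointWitness_reflect (t : ℝ) (i : Fin d) (X : Finset (ZdEdge d))
    (U : LGConfig d (Matrix.specialUnitaryGroup (Fin N) ℂ)) :
    adjointWitness (N := N) t (X.image (fun x : ZdEdge d =>
        if x.2 = i then (zdSiteReflect i x.1 - Pi.single i 1, i) else (zdSiteReflect i x.1, x.2)))
        (configSiteReflect i U) = adjointWitness t X U := by
  classical
  unfold adjointWitness
  by_cases h : ∃ p : ZdPlaquette d, plaquetteEdges p = X
  · have h' : ∃ p : ZdPlaquette d, plaquetteEdges p =
        X.image (fun x : ZdEdge d =>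
        if x.2 = i then (zdSiteReflect i x.1 - Pi.single i 1, i) else (zdSiteReflect i x.1, x.2)) :=
      (exists_plaquetteEdges_eq_image_reflect_iff i X).2 h
    rw [dif_pos h', dif_pos h]
    set p := Classical.choose h with hp
    set p' := Classical.choose h' with hp'
    have hpX : plaquetteEdges p = X := Classical.choose_spec h
    have hp'X : plaquetteEdges p' = X.image (fun x : ZdEdge d => if x.2 = i then (zdSiteReflect i x.1 - Pi.single i 1, i) else (zdSiteReflect i x.1, x.2)) :=
      Classical.choose_spec h'
    obtain ⟨q, hq, hqo⟩ := exists_plaquette_reflect (fundamentalRep (Fin N)) (continuous_fundamentalRep (Fin N)) i p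
    have hpp : p' = q := plaquetteEdges_injective (by rw [hp'X, hq, hpX])
    rw [hpp, hqo]
  · have h' : ¬ ∃ p : ZdPlaquette d, plaquetteEdges p =
        X.image (fun x : ZdEdge d =>
        if x.2 = i then (zdSiteReflect i x.1 - Pi.single i 1, i) else (zdSiteReflect i x.1, x.2)) :=
      fun h'' => h ((exists_plaquetteEdges_eq_image_reflect_iff i X).1 h'')
    rw [dif_neg h', dif_neg h]

/-- **The finite-volume Hamiltonians of the adjoint-plaquette witness are reflection covariant.** [folklore] -/
theorem hamiltonianIn_adjointWitness_reflect (t : ℝ) (Λ : Finset (ZdEdge d)) (i : Fin d)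
    (U : LGConfig d (Matrix.specialUnitaryGroup (Fin N) ℂ)) :
    hamiltonianIn (adjointWitness (N := N) t) plaquetteSupp
        (Λ.image (fun x : ZdEdge d =>
        if x.2 = i then (zdSiteReflect i x.1 - Pi.single i 1, i) else (zdSiteReflect i x.1, x.2)))
        (configSiteReflect i U) = hamiltonianIn (adjointWitness t) plaquetteSupp Λ U := by
  classical
  have hinv := reflectEdge_involutive (d := d) i
  have hinj : Function.Injective (Finset.image (fun x : ZdEdge d => if x.2 = i then (zdSiteReflect i x.1 - Pi.single i 1, i) else (zdSiteReflect i x.1, x.2)) :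
      Finset (ZdEdge d) → Finset (ZdEdge d)) := fun Y Y' hYY' => by
    have := congrArg (Finset.image (fun x : ZdEdge d => if x.2 = i then (zdSiteReflect i x.1 - Pi.single i 1, i) else (zdSiteReflect i x.1, x.2))) hYY'
    rwa [Finset.image_image, Finset.image_image, hinv.comp_self, Finset.image_id, Finset.image_id] at this
  simp only [hamiltonianIn, plaquetteSupp_reflect, Finset.filter_image, Finset.sum_image (hinj.injOn)]
  refine Finset.sum_congr ?_ fun X _ => ?_
  · congr 1
    ext X
    simp only [← Finset.image_inter _ _ hinv.injective, Finset.image_nonempty]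
  · rw [adjointWitness_reflect]

/-- ★ **THE `SU(2)` BHANOT–CREUTZ MIXED ACTION at `β_W = 1/8`, `|t| ≤ 1/100`: ONE STATE, INVARIANT UNDER ALL FOUR AXIS
REFLECTIONS** (on top of its translation and axis-permutation invariance — the full hyperoctahedral symmetry).
[folklore] -/
theorem su2_mixedAction_oneState_reflectInvariant {t : ℝ} (ht : |t| ≤ 1 / 100) (i : Fin 4) :
    ∃ μ : Measure (LGConfig 4 (SUN 2)),
      perturbedGibbsMeasures (d := 4) (fundamentalRep (Fin 2)) (((2 : ℕ) : ℝ) * ((1 / 8 : ℝ) / 4))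
          (adjointWitness t) plaquetteSupp = {μ} ∧ μ.map (configSiteReflect i) = μ :=
  oneState_reflectInvariant_of_perturbedMassGapAt (su2_mixedAction_massGap_1_8 ht)
    (continuous_adjointWitness t) (dependsOn_adjointWitness t) (isSupportedBy_adjointWitness t) i
    (fun Λ U => hamiltonianIn_adjointWitness_reflect t Λ i U)

end Adjoint

end Summit.Ventures.YMGap.RobustBall

end
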